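import Mathlib.Analysis.SpecialFunctions.SmoothTransition
import Mathlib.Analysis.SpecialFunctions.Log.Deriv
import Mathlib.Analysis.InnerProductSpace.Calculus
import Literature.Geometry.Lorentzian.BlackHoles
import HarnessLib

/-!
# Wave energies through graph hypersurfaces of the Kerr–Schild chart; DRSR boundedness for
# admissible hypersurfaces and the reduction of `drsr_wave_boundedness_kerr` (gr.S24)

(family `gr`, statement **gr.S24** infrastructure; trunk G08 = T-LORENTZ; namespaces
`Literature.Lorentz`, `Literature.Lorentz.Kerr`, `Literature.GR`)

`Literature.Geometry.Lorentzian.BlackHoles` vendors the uniform energy boundedness statement of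
Dafermos–Rodnianski–Shlapentokh-Rothman (arXiv:1402.7034 = Ann. of Math. 183 (2016), Thm. 3.1,
estimate (23)) as the named fact `Literature.Geometry.Lorentzian.drsr_wave_boundedness_kerr`, phrased for the leaves
`{t* = τ} ∩ {r > r₊}` of the prelude's **ingoing Kerr–Schild** chart `Kerr.exterior M a`
(`KerrSchild.lean`: `g = η + 2H ℓ ⊗ ℓ` in Cartesian coordinates `(t*, x, y, z)`).

## Why this file exists (fidelity of gr.S24)

DRSR's foliation `Σ_τ = {t*_DRSR = τ}` is **not** the Kerr–Schild foliation. Their Kerr-star time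
(arXiv:1402.7034, §2.1.3, p. 10) is `t*_DRSR = t + t̄(r)` with `t̄(r) = r*(r) − r + const` for
`r ≤ 15M/8` and `t̄(r) = 0` for `r ≥ 9M/4`, i.e. their `Σ_τ` are Boyer–Lindquist slices away from
the black hole; the Kerr–Schild time of the prelude is `t*_KS = t + (r*(r) − r) + const`
**globally** (`dt*_KS = dt + (2Mr/Δ) dr`), so that `t*_KS − t*_DRSR ~ 2M log r → ∞` at spatial
infinity. The two foliations agree near `𝓗⁺` (both have `g(∇t*, ∇t*) = −1 − 2Mr/ρ² = −1 − 2H`)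
but the Kerr–Schild leaves bend logarithmically to the past at infinity and are *not* admissible
hypersurfaces of the first kind in the sense of Dafermos–Rodnianski (arXiv:1010.5132, §4.4,
Def. 4.1: `Σ ∩ {y* ≥ y*_ε} ⊂ ⋃_{|τ'| ≤ ε} φ_{τ+τ'}({t*_DRSR = 0})`). Hence estimate (23), even in
its generalised form (arXiv:1402.7034, §3.3, p. 14: "Theorems 3.1 and 3.2 hold where `Σ₀` is
replaced by an arbitrary admissible hypersurface `Σ̃₀`", by Prop. 4.6.1 of arXiv:1010.5132), does
not *literally* yield `drsr_wave_boundedness_kerr`; the vendored statement is a true **corollary**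
which needs, in addition, two energy identities for the Killing field `T = ∂_{t*}` in the far
region (where `T` is timelike) and the domain of dependence property — exactly the ingredients
Dafermos–Rodnianski use for their Prop. 4.6.1 ("extending initial data, an easy domain of
dependence argument, and the fact that `T` is timelike … near infinity", arXiv:1010.5132, §4.6).

This file makes that reduction explicit and machine-checked. It

* defines coordinate energies through **graph hypersurfaces** `{t* = τ + F(y)}` of an open
  `U ⊆ E4` (`graphSliceEnergy`, `graphSliceEnergyOn`; `F = 0` is `sliceEnergy` of
  `WeightedNorms.lean`), the class of **admissible height functions** `Kerr.IsAdmissibleHeight M F`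
  (Kerr–Schild-graph transcription of admissible hypersurfaces of the first kind) and of
  **admissible waves with data compactly supported on a graph** (`IsAdmissibleKerrWaveOn`, whose
  instance `F = 0` is `IsAdmissibleKerrWave`);
* vendors three named facts (D-0014):
  `DafermosRodnianskiShlapentokhRothman2016_energyBoundedness` (DRSR Thm. 3.1 (23) in the
  generalised form of their §3.3, for Kerr–Schild graphs), `kerr_far_TEnergy_comparison` (the
  `J^T` energy identity between two graphs agreeing near the hole, where `T` is timelike:
  arXiv:1402.7034, §2.3.2 and §2.2.2) and `kerr_finite_speed_of_propagation` (domain of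
  dependence in the ingoing chart, in which the coordinate speed of light is `≤ 1`;
  Bär–Ginoux–Pfäffle 2007, Ch. 3; O'Neill 1983, Ch. 14);
* **proves** `drsr_wave_boundedness_kerr_of`: the three facts imply
  `drsr_wave_boundedness_kerr`. The proof constructs the interpolating height function
  `F(y) = M · χ(‖y‖²/λ² − 1) · log(‖y‖²/λ²)` (`χ = Real.smoothTransition`; `F = 0` on
  `‖y‖ ≤ λ`, `F = 2M log ‖y‖ − 2M log λ` for `‖y‖ ≥ √2 λ`, `|∇F| ≤ 1/2`, `0 ≤ F ≤ ‖y‖/2`) for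
  `λ = λ(M, a)` large, shows that it is admissible, that admissible Kerr waves have compactly
  supported data on its graph (finite speed of propagation), and chains
  `E_KS(τ) ≤ D·E_F(τ) ≤ D·C_A·E_F(0) ≤ D·C_A·D·E_KS(0)` (near parts equal, far parts compared by
  the `J^T` identity; `D = max 1 C_B`).

## Design choices

* **Coordinate energies.** As in `WeightedNorms.lean`, energies are the coordinate (non-degenerate)
  energies `∫ ∑_μ (∂_μ ψ)² dy` on the graph, with values in `ℝ≥0∞`. On a uniformly spacelike graph
  of bounded slope these are comparable, with constants depending only on `(M, a)` and the slope
  bound, to DRSR's flux `∫ J^N_μ n^μ dVol` (`N`, `n` uniformly timelike with bounded Kerr–Schild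
  components, `H ≤ M/r₊`, induced metric `h ≥ (1 − |∇F|²) δ` since `H ≥ 0`; arXiv:1402.7034,
  display after (23), p. 13); the constants are absorbed in the facts' `∃ C`.
* **Admissible heights.** `Kerr.IsAdmissibleHeight M F`: `F` smooth, `‖dF‖ ≤ 1 − c` for some
  `c > 0` (so every translate `{t* = τ + F}` is spacelike with margin for *every* Kerr–Schild
  metric `η + 2H ℓ ⊗ ℓ`, `H ≥ 0`), and `F(y) − 2M log ‖y‖ → τ₀` uniformly as `‖y‖ → ∞` (the graph
  is asymptotic to the `τ₀`-translate of DRSR's `{t*_DRSR = 0} = {t*_KS = r* − r + const}`,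
  `r* − r = 2M log r + const + o(1)`, `log r − log ‖y‖ → 0`): conditions (i)–(iii) of
  arXiv:1010.5132, Def. 4.1 for the parameters `(a₀, M) = (|a|, M)`. The slope bound is *stronger*
  than DRSR's spacelikeness (their own `{t*_DRSR = 0}` is steep in Kerr–Schild coordinates near
  `r ≈ 2M` and is not in this class), which only weakens the vendored fact. One clause is not
  transcribed: Def. 4.1 (i) asks spacelikeness "for all `|a'| ≤ a₀`" of the *same* subset of
  DRSR's fixed ambient manifold `𝓡`, whose identification with the Kerr–Schild chart is
  parameter-dependent and not printed in closed form (`r(y*)` for `r < 3M`, `t̄` on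
  `[15M/8, 9M/4]`); for a single parameter value `a` (take `a₀ = |a|`) this clause serves only
  the uniformity of constants in `a` (arXiv:1010.5132, p. 17: "For reasons concerning dependence of
  constants on `a₀` … it is convenient to require these properties for all hypersurfaces"). This
  is recorded in the docstring of the fact.
* **The two auxiliary facts are stated in coordinates**, with explicit margins (`2H ≤ 1 − c` on
  the far region, slopes `≤ 1 − c`) rather than through the prelude's abstract causal notions, so
  that the reduction is elementary measure theory; their docstrings give the printed identities
  they instantiate. Both are provable in principle from the Kerr–Schild formulas (`det g = −1`,
  `∂_μ (J^T)^μ = 0`, Leibniz rule; energy estimates), which is left to prover items.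
* Nothing here duplicates Mathlib (no Lorentzian wave equations there); we use `lintegral`,
  `Real.smoothTransition`, `fderiv`, `innerSL`, `IsCompact`, `Filter.cocompact`.

## References

* M. Dafermos, I. Rodnianski, Y. Shlapentokh-Rothman, *Decay for solutions of the wave equation
  on Kerr exterior spacetimes III: the full subextremal case `|a| < M`*, Ann. of Math. 183 (2016)
  787–913, arXiv:1402.7034: §2.1.3 (Kerr-star vs Boyer–Lindquist time, p. 10), §2.2.2, §2.2.5,
  §2.3.2 (divergence identity, p. 12), Thm. 3.1 (23) and the display following it (p. 13), §3.3
  (generalisation to admissible `Σ̃₀`, p. 14), §4.1 (key `DafermosRodnianskiShlapentokhrothman2014`).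
* M. Dafermos, I. Rodnianski, *Decay for solutions of the wave equation on Kerr exterior
  spacetimes I–II*, arXiv:1010.5132: §4.4 Def. 4.1 (admissible hypersurfaces), §4.5 Prop. 4.5.1
  (well-posedness), §4.6 Prop. 4.6.1 (key `DafermosRodnianski2010KerrSmallA`).
* M. Dafermos, I. Rodnianski, *Lectures on black holes and linear waves*, arXiv:0811.0354, §5.1
  (key `DafermosRodnianski2008`).
* C. Bär, N. Ginoux, F. Pfäffle, *Wave equations on Lorentzian manifolds and quantization*, EMS
  2007, arXiv:0806.1036, Ch. 3, Sect. 2 "The Cauchy problem": uniqueness corollary (Cor. 2.4 of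
  that section in the arXiv version) and the main theorem (Thm. 2.9 ibid.: `supp u ⊂ J^M(K)`)
  (key `BarGinouxPfaffle2007`).
* B. O'Neill, *Semi-Riemannian geometry*, Academic Press 1983, Ch. 14, Def. 35, Thm. 38,
  Lemma 43 (Cauchy developments are globally hyperbolic) (key `ONeillSemiRiemannian1983`).
-/

noncomputable section

open Bundle Set Manifold TopologicalSpace Filter MeasureTheory
open scoped ContDiff Topology ENNReal Manifold

namespace Literature.Geometry.Lorentzian

/-! ### Coordinate energies through graph hypersurfaces `{t* = τ + F(y)}` -/

section GraphEnergy

variable (U : Opens E4) (ψ : U → ℝ) (F : E3 → ℝ) (τ : ℝ)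

/-- The **coordinate energy of `ψ : U → ℝ` through the graph hypersurface `{t* = τ + F(y)}`,
restricted to `y ∈ S`**: `∫_{y ∈ S, (τ + F(y), y) ∈ U} ∑_μ (∂_μ ψ)² (τ + F(y), y) dy ∈ [0, ∞]`
(Lebesgue measure `dy` on `E3`, integrand `coordEnergyDensity` of `WeightedNorms.lean` cut off to
`U` by `Set.indicator`). For a uniformly spacelike graph of bounded slope this is comparable to the
energy flux `∫_{Σ̃ ∩ S} J^N_μ[ψ] n^μ_{Σ̃}` of Dafermos–Rodnianski–Shlapentokh-Rothman through
`Σ̃ = {t* = τ + F}` (arXiv:1402.7034, §3.1, display after (23); §3.3 for hypersurfaces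
`Σ̃_τ = φ_τ(Σ̃₀)`). `S = {R' < ‖y‖}` is the "far part" used in the `J^T` comparison.
[cite: DafermosRodnianskiShlapentokhrothman2014, §3.1 display after (23); §3.3] -/
def graphSliceEnergyOn (S : Set E3) : ℝ≥0∞ :=
  ∫⁻ y in S, Set.indicator {y | E4.ofTimeSpace (τ + F y) y ∈ U}
    (fun y ↦ ENNReal.ofReal (coordEnergyDensity U ψ (E4.ofTimeSpace (τ + F y) y))) y

/-- The **coordinate energy of `ψ` through the whole graph hypersurface `{t* = τ + F(y)} ∩ U`**:
`∫_{(τ + F(y), y) ∈ U} ∑_μ (∂_μ ψ)² (τ + F(y), y) dy ∈ [0, ∞]`; for `F = 0` this is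
`sliceEnergy U ψ τ` (`graphSliceEnergy_zero_height`). The graphs `{t* = τ + F}`, `τ ≥ 0`, are the
time-translates `φ_τ(Σ̃₀)` of `Σ̃₀ = {t* = F}` (arXiv:1402.7034, §3.3).
[cite: DafermosRodnianskiShlapentokhrothman2014, §3.3] -/
def graphSliceEnergy : ℝ≥0∞ :=
  ∫⁻ y : E3, Set.indicator {y | E4.ofTimeSpace (τ + F y) y ∈ U}
    (fun y ↦ ENNReal.ofReal (coordEnergyDensity U ψ (E4.ofTimeSpace (τ + F y) y))) y

/-- The energy restricted to `S = E3` is the total graph energy (`Measure.restrict_univ`).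
[folklore] -/
@[simp]
theorem graphSliceEnergyOn_univ :
    graphSliceEnergyOn U ψ F τ Set.univ = graphSliceEnergy U ψ F τ := by
  simp [graphSliceEnergyOn, graphSliceEnergy]

/-- The energy through a part of the graph is at most the total graph energy. [folklore] -/
theorem graphSliceEnergyOn_le (S : Set E3) :
    graphSliceEnergyOn U ψ F τ S ≤ graphSliceEnergy U ψ F τ :=
  setLIntegral_le_lintegral _ _

/-- The restricted graph energy is monotone in the set. [folklore] -/
theorem graphSliceEnergyOn_mono {S S' : Set E3} (h : S ⊆ S') :
    graphSliceEnergyOn U ψ F τ S ≤ graphSliceEnergyOn U ψ F τ S' :=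
  lintegral_mono_set h

/-- **Near/far decomposition**: for measurable `S`, the energies through the parts of the graph
over `S` and over `Sᶜ` add up to the total graph energy (`lintegral_add_compl`). [folklore] -/
theorem graphSliceEnergyOn_add_compl {S : Set E3} (hS : MeasurableSet S) :
    graphSliceEnergyOn U ψ F τ S + graphSliceEnergyOn U ψ F τ Sᶜ = graphSliceEnergy U ψ F τ :=
  lintegral_add_compl _ hS

/-- For the zero height function the graph `{t* = τ + 0}` is the Kerr–Schild leaf `{t* = τ}` and
the graph energy is `sliceEnergy` of `WeightedNorms.lean`. [folklore] -/
@[simp]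
theorem graphSliceEnergy_zero_height : graphSliceEnergy U ψ 0 τ = sliceEnergy U ψ τ := by
  simp [graphSliceEnergy, sliceEnergy]

/-- Two height functions agreeing on a measurable set `S` have the same graph energy over `S`
(the graphs coincide there). [folklore] -/
theorem graphSliceEnergyOn_congr_height {F G : E3 → ℝ} {S : Set E3} (hS : MeasurableSet S)
    (h : ∀ y ∈ S, F y = G y) :
    graphSliceEnergyOn U ψ F τ S = graphSliceEnergyOn U ψ G τ S := by
  classical
  refine setLIntegral_congr_fun hS fun y hy ↦ ?_
  show Set.indicator _ _ y = Set.indicator _ _ y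
  simp only [Set.indicator_apply, Set.mem_setOf_eq, h y hy]

end GraphEnergy

/-- Joint continuity of `(f, g⃗) ↦ (f, g⃗) ∈ E4` (each component is continuous; cf.
`E4.continuous_ofTimeSpace` for constant `f`). Coordinate bookkeeping for graphs
`y ↦ (F(y), y)`; Dafermos–Rodnianski, arXiv:0811.0354, §5.1. [folklore] -/
theorem E4.continuous_ofTimeSpace' {X : Type*} [TopologicalSpace X] {f : X → ℝ} {g : X → E3}
    (hf : Continuous f) (hg : Continuous g) :
    Continuous fun x ↦ E4.ofTimeSpace (f x) (g x) := by
  refine (PiLp.continuous_toLp 2 _).comp ?_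
  refine continuous_pi fun i => ?_
  refine Fin.cases ?_ (fun j => ?_) i
  · simpa using hf
  · simpa [Function.comp_def] using (PiLp.continuous_apply 2 _ j).comp hg

namespace Kerr

/-! ### Kerr–Schild bookkeeping: time-translation invariance, `H ≤ M / r`, the far region -/

/-- The Kerr–Schild radius does not depend on the time coordinate: `r(t, y) = r(0, y)` (it is a
function of `‖y‖` and `z = y₃` only; Visser arXiv:0706.0622, (35)). [folklore] -/
theorem radius_ofTimeSpace (a t : ℝ) (y : E3) :
    radius a (E4.ofTimeSpace t y) = radius a (E4.ofTimeSpace 0 y) := by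
  have h3 : (E4.ofTimeSpace t y) 3 = (E4.ofTimeSpace 0 y) 3 := by
    show (E4.ofTimeSpace t y) (Fin.succ 2) = (E4.ofTimeSpace 0 y) (Fin.succ 2)
    rw [E4.ofTimeSpace_apply_succ, E4.ofTimeSpace_apply_succ]
  simp only [radius, E4.spatialNorm_ofTimeSpace, h3]

/-- Time-translation invariance of the chart domains: `(t, y) ∈ Kerr.region a r₀ ↔ y ∈
Kerr.slice a r₀` for every `t` (the regions are `ℝ_{t*} × {r > max r₀ 0}`; Dafermos–Rodnianski
arXiv:0811.0354, §5.1; DRSR arXiv:1402.7034, §2.1.1: `φ_τ` acts by `t* ↦ t* + τ`). [folklore] -/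
theorem ofTimeSpace_mem_region_iff {a r₀ t : ℝ} {y : E3} :
    E4.ofTimeSpace t y ∈ region a r₀ ↔ y ∈ slice a r₀ := by
  rw [mem_region, mem_slice, radius_ofTimeSpace]

/-- `(t, y)` lies in the Kerr exterior iff `y` lies in the exterior slice `{r > r₊}`, for every
`t` (time-translation invariance of `{r > r₊}`; arXiv:1402.7034, §2.1.1). [folklore] -/
theorem ofTimeSpace_mem_exterior_iff {M a t : ℝ} {y : E3} :
    E4.ofTimeSpace t y ∈ exterior M a ↔ y ∈ slice a (rPlus M a) :=
  ofTimeSpace_mem_region_iff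

/-- `H = M r³ / (r⁴ + a² z²) ≤ M / r` for `M ≥ 0`, `r > 0` (drop `a² z² ≥ 0`; Visser
arXiv:0706.0622, (33)). [folklore] -/
theorem scalarH_le_div {M : ℝ} (hM : 0 ≤ M) (a : ℝ) {x : E4} (hx : 0 < radius a x) :
    scalarH M a x ≤ M / radius a x := by
  unfold scalarH
  have hr4 : 0 < radius a x ^ 4 := by positivity
  calc M * radius a x ^ 3 / (radius a x ^ 4 + a ^ 2 * x 3 ^ 2)
      ≤ M * radius a x ^ 3 / radius a x ^ 4 := by
        apply div_le_div_of_nonneg_left (by positivity) hr4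
        nlinarith [sq_nonneg (a * x 3)]
    _ = M / radius a x := by
        field_simp

/-- `‖x⃗‖² − a² ≤ r²`: from `r² = ((ρ² − a²) + √((ρ² − a²)² + 4a²z²)) / 2` and
`√(⋯) ≥ |ρ² − a²|` (Visser arXiv:0706.0622, (35)). [folklore] -/
theorem spatialNorm_sq_sub_sq_le_radius_sq (a : ℝ) (x : E4) :
    E4.spatialNorm x ^ 2 - a ^ 2 ≤ radius a x ^ 2 := by
  rw [radius_sq]
  linarith [abs_le_sqrt_radius_discr a x, le_abs_self (E4.spatialNorm x ^ 2 - a ^ 2)]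

/-- **`T = ∂_{t*}` is uniformly timelike far out.** For subextremal `(M, a)` and `x` in the
exterior with `‖x⃗‖ ≥ 8M` one has `2H(x) ≤ 1/2`, hence `g(∂_{t*}, ∂_{t*}) = −1 + 2H ≤ −1/2`
(`r² ≥ ‖x⃗‖² − a² ≥ 63 M²`, so `r ≥ 4M` and `H ≤ M/r ≤ 1/4`). The ergoregion lies in `{r < 2M}`
(O'Neill 1995, Ch. 2, §2.4; DRSR arXiv:1402.7034, §2.2.4). [folklore] -/
theorem two_mul_scalarH_le_half {M a : ℝ} (hMa : IsSubextremal M a) {x : E4}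
    (hx : x ∈ exterior M a) (hfar : 8 * M ≤ E4.spatialNorm x) :
    2 * scalarH M a x ≤ 1 / 2 := by
  have hM : 0 < M := hMa.pos
  have hr0 : 0 < radius a x := radius_pos_of_mem_region hx
  have ha : a ^ 2 < M ^ 2 := sq_lt_sq' (abs_lt.1 hMa).1 (abs_lt.1 hMa).2
  have h1 := spatialNorm_sq_sub_sq_le_radius_sq a x
  have hsn : 0 ≤ E4.spatialNorm x := E4.spatialNorm_nonneg x
  have h64 : 64 * M ^ 2 ≤ E4.spatialNorm x ^ 2 := by nlinarith
  have hr2 : 16 * M ^ 2 ≤ radius a x ^ 2 := by nlinarith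
  have hr : 4 * M ≤ radius a x := by nlinarith [radius_nonneg a x]
  have hH := scalarH_le_div hM.le a hr0
  have : M / radius a x ≤ 1 / 4 := by
    rw [div_le_div_iff₀ hr0 (by norm_num : (0:ℝ) < 4)]
    linarith
  linarith

/-! ### Admissible height functions (admissible hypersurfaces of the first kind, as graphs) -/

/-- **Admissible height functions** for the Kerr–Schild chart of mass parameter `M`: the
transcription, for graphs `Σ̃₀ = {t* = F(y)}` over the exterior slice, of Dafermos–Rodnianski's
*admissible hypersurfaces of the first kind* (arXiv:1010.5132, §4.4, Def. 4.1), to which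
Dafermos–Rodnianski–Shlapentokh-Rothman extend their Theorem 3.1 (arXiv:1402.7034, §3.3, p. 14).
We require: (i') `F` is `C^∞` with **slope bounded away from the speed of light**,
`‖dF(y)‖ ≤ 1 − c` for some `c > 0` and all `y` — since `g⁻¹(dt − dF, dt − dF) = −1 + |∇F|² −
2H (1 + ℓ⃗·∇F)² ≤ −(1 − |∇F|²)` (`H ≥ 0`), every translate `{t* = τ + F}` is then spacelike
with a uniform margin, which is Def. 4.1 (i) in quantitative form (and stronger: DRSR's prototype
`{t*_DRSR = 0}` is steep in Kerr–Schild coordinates near `r ≈ 2M` and is not in this class);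
(ii) is automatic for graphs of functions smooth up to the horizon sphere `{r = r₊}`; (iii')
`F(y) − 2M log ‖y‖ → τ₀` uniformly as `‖y‖ → ∞` (`Filter.cocompact`), which is Def. 4.1 (iii):
the prototype `Σ₁ = {t*_DRSR = 0}` is `{t*_KS = r* − r − t̄(r) + const}` with `t̄ = 0` for
`r ≥ 9M/4` (arXiv:1402.7034, §2.1.3) and `r* − r = 2M log r + const + o(1)`, `log r − log ‖y‖ → 0`,
so (iii') says that the graph is eventually within every slab `⋃_{|τ'| ≤ ε} φ_{τ₀'+τ'}(Σ₁)`.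
Not transcribed: the clause "for all `|a'| ≤ a₀`" of Def. 4.1 (i) (see the module docstring; we
use `a₀ = |a|`). [cite: DafermosRodnianski2010KerrSmallA, §4.4 Def. 4.1] -/
def IsAdmissibleHeight (M : ℝ) (F : E3 → ℝ) : Prop :=
  ContDiff ℝ ∞ F ∧ (∃ c : ℝ, 0 < c ∧ ∀ y : E3, ‖fderiv ℝ F y‖ ≤ 1 - c) ∧
    ∃ τ₀ : ℝ, Tendsto (fun y : E3 ↦ F y - 2 * M * Real.log ‖y‖) (cocompact E3) (𝓝 τ₀)

/-- An admissible height function is smooth (first clause; arXiv:1010.5132, Def. 4.1).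
[folklore] -/
lemma IsAdmissibleHeight.contDiff {M : ℝ} {F : E3 → ℝ} (h : IsAdmissibleHeight M F) :
    ContDiff ℝ ∞ F :=
  h.1

/-- An admissible height function has slope at most `1 − c < 1` for some `c > 0` (second clause;
arXiv:1010.5132, Def. 4.1 (i)). [folklore] -/
lemma IsAdmissibleHeight.exists_slope_le {M : ℝ} {F : E3 → ℝ} (h : IsAdmissibleHeight M F) :
    ∃ c : ℝ, 0 < c ∧ ∀ y : E3, ‖fderiv ℝ F y‖ ≤ 1 - c :=
  h.2.1

end Kerr

end Literature.Geometry.Lorentzian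

namespace Literature.Geometry.Lorentzian


/-! ### Waves with data compactly supported on a graph; the three named facts -/

/-- **Admissible scalar waves with data on the graph `{t* = F(y)}`.** `ψ : Kerr.exterior M a → ℝ`
is smooth, solves `□_g ψ = 0` on the exterior (d'Alembertian of the `C^∞` Kerr metric under
`[Kerr.Facts] [Kerr.SliceFacts]`, as in `IsAdmissibleKerrWave`), and its Cauchy data on the graph
hypersurface `{t* = F(y)} ∩ {r > r₊}` are compactly supported in the open graph: there is a
compact `K` such that `ψ` and `dψ` vanish at every point `x` of the exterior with `x⁰ = F(x⃗)`
outside `K`. For `F = 0` this is `IsAdmissibleKerrWave` (`isAdmissibleKerrWaveOn_zero_iff`). This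
is the class "`ψ` arising from smooth compactly supported data on `Σ̃₀`" of DRSR (arXiv:1402.7034,
§4.1 with §3.3), restricted to solutions defined on the whole exterior chart.
[cite: DafermosRodnianskiShlapentokhrothman2014, §4.1; §3.3] -/
def IsAdmissibleKerrWaveOn [Kerr.Facts] [Kerr.SliceFacts] (M a : ℝ) (F : E3 → ℝ)
    (ψ : Kerr.exterior M a → ℝ) : Prop :=
  ContMDiff 𝓘(ℝ, E4) 𝓘(ℝ, ℝ) ∞ ψ ∧
    (∀ x, (Kerr.smoothMetric M a (Kerr.rPlus M a)).toPseudoRiemannianMetric.dalembertian ψ x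
      = 0) ∧
    ∃ K : Set (Kerr.exterior M a), IsCompact K ∧
      ∀ x : Kerr.exterior M a, (x : E4) 0 = F (E4.spatial (x : E4)) → x ∉ K →
        ψ x = 0 ∧ mfderiv 𝓘(ℝ, E4) 𝓘(ℝ, ℝ) ψ x = 0

/-- For the zero height function, "admissible on the graph of `0`" is `IsAdmissibleKerrWave`
(data compactly supported on the Kerr–Schild leaf `{t* = 0}`; arXiv:1402.7034, §4.1).
[folklore] -/
theorem isAdmissibleKerrWaveOn_zero_iff [Kerr.Facts] [Kerr.SliceFacts] {M a : ℝ}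
    {ψ : Kerr.exterior M a → ℝ} :
    IsAdmissibleKerrWaveOn M a 0 ψ ↔ IsAdmissibleKerrWave M a ψ := by
  simp [IsAdmissibleKerrWaveOn, IsAdmissibleKerrWave]

/-- The zero function is an admissible wave on every graph (the class is non-empty; constants
solve the wave equation, `dalembertian_const`, and `K = ∅` works). [folklore] -/
lemma isAdmissibleKerrWaveOn_zero [Kerr.Facts] [Kerr.SliceFacts] (M a : ℝ) (F : E3 → ℝ) :
    IsAdmissibleKerrWaveOn M a F (fun _ ↦ 0) :=
  ⟨contMDiff_const, fun x ↦ PseudoRiemannianMetric.dalembertian_const _ 0 x,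
    ⟨∅, isCompact_empty, fun _ _ _ ↦ ⟨rfl, mfderiv_const⟩⟩⟩

/-- **Dafermos–Rodnianski–Shlapentokh-Rothman, uniform energy boundedness through admissible
hypersurfaces** (arXiv:1402.7034 = Ann. of Math. 183 (2016), Thm. 3.1, estimate (23), in the
generalised form of §3.3, p. 14: "Theorems 3.1 and 3.2 hold where `Σ₀` is replaced by an
arbitrary 'admissible' hypersurface `Σ̃₀` (see Section 4.4 of [dr7] for this notion), `Σ_τ` is
replaced by `Σ̃_τ ≐ φ_τ(Σ̃₀)`, `n_{Σ_τ}` is replaced by `n_{Σ̃_τ}`, `𝓡₀`, `𝓗⁺₀` are redefined as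
`D⁺(Σ̃₀)`, `D⁺(Σ̃₀) ∩ 𝓗⁺`", proven as Prop. 4.6.1 of arXiv:1010.5132). As printed: for `M > 0`,
`0 ≤ a₀ < M` there is `C` such that for all `|a| ≤ a₀` and all sufficiently regular solutions
of `□_{g_{a,M}} ψ = 0` on `D⁺(Σ̃₀)`, `∫_{Σ̃_τ} J^N_μ[ψ] n^μ_{Σ̃_τ} ≤ C ∫_{Σ̃₀} J^N_μ[ψ] n^μ_{Σ̃₀}`
for all `τ ≥ 0` (`N` any `φ_τ`-invariant strictly timelike vector field asymptotic to `T`,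
e.g. `n_Σ`; the constant for a general admissible `Σ̃₀` depends also on `Σ̃₀`, loc. cit.
Prop. 4.6.1: `B(Σ, M)`). **Vendored form** (weaker): for subextremal `(M, a)` (`a₀ = |a|`) and
every admissible height function `F` (`Kerr.IsAdmissibleHeight M F`: Kerr–Schild graph
`Σ̃₀ = {t* = F(y)}`, admissible of the first kind) there is `C = C(M, a, F) < ∞` such that every
smooth solution `ψ` on the exterior with data compactly supported on the open graph
(`IsAdmissibleKerrWaveOn M a F ψ`; by arXiv:1010.5132, Prop. 4.5.1 and uniqueness in `D⁺(Σ̃₀)`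
it agrees on `D⁺(Σ̃₀) ∩ {r > r₊} ⊇ Σ̃_τ ∩ {r > r₊}`, `τ ≥ 0`, with DRSR's solution for these data
extended by zero to `Σ̃₀ ∩ 𝓗⁺`) satisfies `E_F(τ) ≤ C · E_F(0)` for all `τ ≥ 0`, where `E_F(τ) =
graphSliceEnergy (Kerr.exterior M a) ψ F τ` is the coordinate energy through `Σ̃_τ = {t* = τ + F}`,
comparable to `∫_{Σ̃_τ} J^N_μ n^μ` with constants depending on `(M, a)` and the slope bound of `F`
(module docstring). Not transcribed: the clause "for all `|a'| ≤ a₀`" in Def. 4.1 (i) of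
arXiv:1010.5132 (see `Kerr.IsAdmissibleHeight`). The 130-page proof (frequency-localised
multipliers for Carter's separated equations, mode stability, continuity in `a`; §3.4) is not
reproduced: this is a named fact (D-0014).
[cite: DafermosRodnianskiShlapentokhrothman2014, Thm. 3.1 (23) with §3.3 (p. 14)] -/
def DafermosRodnianskiShlapentokhRothman2016_energyBoundedness : Prop :=
  ∀ [Kerr.Facts] [Kerr.SliceFacts] (M a : ℝ), Kerr.IsSubextremal M a →
    ∀ F : E3 → ℝ, Kerr.IsAdmissibleHeight M F →
      ∃ C : ℝ≥0∞, C < ⊤ ∧ ∀ ψ : Kerr.exterior M a → ℝ, IsAdmissibleKerrWaveOn M a F ψ →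
        ∀ τ : ℝ, 0 ≤ τ →
          graphSliceEnergy (Kerr.exterior M a) ψ F τ ≤
            C * graphSliceEnergy (Kerr.exterior M a) ψ F 0

/-- **The `J^T` energy identity in the far region, between two graphs that agree near the black
hole.** Printed ingredients: the divergence identity `∫_{S⁺} J^V_μ n^μ + ∫_𝓑 (K^V + 𝓔^V) =
∫_{S⁻} J^V_μ n^μ` between homologous spacelike hypersurfaces (DRSR arXiv:1402.7034, §2.3.2,
p. 12, with `V = T`: `K^T = 0` since `T = ∂_{t*}` is Killing, §2.2.2, and `𝓔^T = 0` for
solutions), and the comparability `J^X_μ Y^μ = 𝐓(X, Y) ∼ ∑_μ (∂_μ ψ)²` for two future timelike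
vectors with margins and bounded components (loc. cit. §3.1, display after (23); `T` is timelike
exactly off the ergoregion, §2.2.4) — the argument of Dafermos–Rodnianski for Prop. 4.6.1 of
arXiv:1010.5132 ("the fact that `T` is timelike … near infinity"). **Vendored statement** (in the
ingoing Kerr–Schild chart, where `det g = −1`): let `(M, a)` be subextremal, `F₁ ≤ F₂` two `C^∞`
height functions with slopes `≤ 1 − c` which *coincide on `{‖y‖ ≤ R'}`*, such that
`{‖y‖ > R'}` lies in the exterior slice and `2H ≤ 1 − c` (i.e. `g(∂_{t*}, ∂_{t*}) ≤ −c`) on the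
exterior points with `‖x⃗‖ ≥ R'`. Then there is `C = C(M, a, F₁, F₂, R', c) < ∞` such that for
every smooth solution `ψ` of `□_g ψ = 0` on the exterior and every `τ`, if `ψ, dψ` vanish at all
points of the wedge `{τ + F₁(x⃗) ≤ x⁰ ≤ τ + F₂(x⃗)}` with `‖x⃗‖ ≥ ρ` for some `ρ`, the coordinate
energies through the far parts `{‖y‖ > R'}` of the two graphs `{t* = τ + F_i}` are comparable:
`E^{far}_{F₂}(τ) ≤ C E^{far}_{F₁}(τ)` and `E^{far}_{F₁}(τ) ≤ C E^{far}_{F₂}(τ)`. (Apply the identity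
on the bounded wedge over `{R' < ‖y‖ < ρ'}`, whose lateral boundaries carry no flux: at
`‖y‖ = R'` the wedge is pinched since `F₁ = F₂` there, beyond `ρ` the solution vanishes; then
`(J^T)^μ ν_μ ∼ ∑_μ (∂_μ ψ)²` on both graphs, `ν = dt* − dF_i`.)
[cite: DafermosRodnianskiShlapentokhrothman2014, §2.3.2 (divergence identity, V = T), §2.2.2, §3.1 display after (23)] -/
def kerr_far_TEnergy_comparison : Prop :=
  ∀ [Kerr.Facts] [Kerr.SliceFacts] (M a : ℝ), Kerr.IsSubextremal M a →
    ∀ (F₁ F₂ : E3 → ℝ) (R' c : ℝ), 0 < c →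
      ContDiff ℝ ∞ F₁ → ContDiff ℝ ∞ F₂ →
      (∀ y, ‖fderiv ℝ F₁ y‖ ≤ 1 - c) → (∀ y, ‖fderiv ℝ F₂ y‖ ≤ 1 - c) →
      (∀ y : E3, ‖y‖ ≤ R' → F₁ y = F₂ y) → (∀ y, F₁ y ≤ F₂ y) →
      (∀ y : E3, R' < ‖y‖ → y ∈ Kerr.slice a (Kerr.rPlus M a)) →
      (∀ x : E4, x ∈ Kerr.exterior M a → R' ≤ E4.spatialNorm x →
        2 * Kerr.scalarH M a x ≤ 1 - c) →
      ∃ C : ℝ≥0∞, C < ⊤ ∧ ∀ (ψ : Kerr.exterior M a → ℝ) (τ : ℝ),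
        ContMDiff 𝓘(ℝ, E4) 𝓘(ℝ, ℝ) ∞ ψ →
        (∀ x, (Kerr.smoothMetric M a (Kerr.rPlus M a)).toPseudoRiemannianMetric.dalembertian ψ x
          = 0) →
        (∃ ρ : ℝ, ∀ x : Kerr.exterior M a,
            τ + F₁ (E4.spatial (x : E4)) ≤ (x : E4) 0 → (x : E4) 0 ≤ τ + F₂ (E4.spatial (x : E4)) →
            ρ ≤ E4.spatialNorm (x : E4) → ψ x = 0 ∧ mfderiv 𝓘(ℝ, E4) 𝓘(ℝ, ℝ) ψ x = 0) →
        graphSliceEnergyOn (Kerr.exterior M a) ψ F₂ τ {y | R' < ‖y‖} ≤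
            C * graphSliceEnergyOn (Kerr.exterior M a) ψ F₁ τ {y | R' < ‖y‖} ∧
          graphSliceEnergyOn (Kerr.exterior M a) ψ F₁ τ {y | R' < ‖y‖} ≤
            C * graphSliceEnergyOn (Kerr.exterior M a) ψ F₂ τ {y | R' < ‖y‖}

/-- **Finite speed of propagation in the ingoing Kerr–Schild chart.** Printed ingredients: for
the Cauchy problem of a normally hyperbolic operator on a globally hyperbolic manifold with smooth
spacelike Cauchy hypersurface `S`, solutions are unique and `supp u ⊂ J(supp data)` (Bär–Ginoux–
Pfäffle 2007 = arXiv:0806.1036, Ch. 3, Sect. 2, uniqueness corollary and main theorem — Cor. 2.4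
and Thm. 2.9 of that section in the arXiv numbering); the Cauchy development `D(S)` of an acausal
hypersurface is open and globally hyperbolic, with `S` "playing the role of Cauchy hypersurface"
(O'Neill 1983, Ch. 14, "Cauchy developments": Def. 35, Thm. 38, Lemma 43); in the ingoing Kerr–Schild chart with
`M ≥ 0` every causal vector `v` has `|v⃗| ≤ |v⁰|` (`0 ≥ g(v, v) = −(v⁰)² + |v⃗|² + 2H ℓ(v)²`,
`H ≥ 0`), the leaves `{t* = τ}` are spacelike and `t*` increases along future causal curves
(`−g♯ dt*` is the time orientation), and past-directed causal curves in `{r > r₊}` do not reach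
`𝓗⁺` at finite `t*` (DRSR arXiv:1402.7034, §2.2.5: `Σ₀` is a past Cauchy hypersurface of `𝓡₀`).
**Vendored consequence**: for subextremal `(M, a)` and a smooth solution `ψ` of `□_g ψ = 0` on the
exterior whose data on the leaf `{t* = 0} ∩ {r > r₊}` vanish at all points with `‖x⃗‖ > ρ`, one
has `ψ(x) = 0` and `dψ(x) = 0` at every exterior point with `x⁰ ≥ 0` and `‖x⃗‖ > ρ + x⁰` (such a
point lies in the interior of `D⁺` of the open part `{‖y‖ > ρ}` of the leaf, on which the data
vanish: its coordinate past cone meets `{t* = 0}` inside `{‖y − x⃗‖ ≤ x⁰} ⊂ {‖y‖ > ρ}`).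
[cite: BarGinouxPfaffle2007, Ch. 3 Sect. 2 (Cor. 2.4, Thm. 2.9 of the arXiv version); O'Neill 1983 Ch. 14 Thm. 38, Lemma 43] -/
def kerr_finite_speed_of_propagation : Prop :=
  ∀ [Kerr.Facts] [Kerr.SliceFacts] (M a : ℝ), Kerr.IsSubextremal M a →
    ∀ ψ : Kerr.exterior M a → ℝ, ContMDiff 𝓘(ℝ, E4) 𝓘(ℝ, ℝ) ∞ ψ →
      (∀ x, (Kerr.smoothMetric M a (Kerr.rPlus M a)).toPseudoRiemannianMetric.dalembertian ψ x
        = 0) →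
      ∀ ρ : ℝ, (∀ x : Kerr.exterior M a, (x : E4) 0 = 0 → ρ < E4.spatialNorm (x : E4) →
          ψ x = 0 ∧ mfderiv 𝓘(ℝ, E4) 𝓘(ℝ, ℝ) ψ x = 0) →
        ∀ x : Kerr.exterior M a, 0 ≤ (x : E4) 0 → ρ + (x : E4) 0 < E4.spatialNorm (x : E4) →
          ψ x = 0 ∧ mfderiv 𝓘(ℝ, E4) 𝓘(ℝ, ℝ) ψ x = 0

/-! ### The interpolating height function `F(y) = M · χ(‖y‖²/λ² − 1) · log(‖y‖²/λ²)` -/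

/-- The radial profile `g(s) = χ(s − 1) log s` of the interpolating height function
(`χ = Real.smoothTransition`): `g = 0` on `s ≤ 1`, `g = log s` on `s ≥ 2`, smooth and
nonnegative. A standard cutoff construction (cf. the hypersurfaces `Σ₂ = {t* = χ(α(y* − R))·(r +
M log r)}` of arXiv:1010.5132, §4.4). [folklore] -/
def heightProfile (s : ℝ) : ℝ := Real.smoothTransition (s - 1) * Real.log s

/-- `g(s) = 0` for `s ≤ 1` (the cutoff vanishes). [folklore] -/
theorem heightProfile_of_le_one {s : ℝ} (hs : s ≤ 1) : heightProfile s = 0 := by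
  rw [heightProfile, Real.smoothTransition.zero_of_nonpos (by linarith), zero_mul]

/-- `g(s) = log s` for `s ≥ 2` (the cutoff is `1`). [folklore] -/
theorem heightProfile_of_two_le {s : ℝ} (hs : 2 ≤ s) : heightProfile s = Real.log s := by
  rw [heightProfile, Real.smoothTransition.one_of_one_le (by linarith), one_mul]

/-- `g ≥ 0` (`log s ≥ 0` where the cutoff is nonzero). [folklore] -/
theorem heightProfile_nonneg (s : ℝ) : 0 ≤ heightProfile s := by
  rcases le_or_gt s 1 with hs | hs
  · rw [heightProfile_of_le_one hs]
  · exact mul_nonneg (Real.smoothTransition.nonneg _) (Real.log_nonneg hs.le)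

/-- `g(s) ≤ log s` for `s ≥ 1` (the cutoff is at most `1`). [folklore] -/
theorem heightProfile_le_log {s : ℝ} (hs : 1 ≤ s) : heightProfile s ≤ Real.log s := by
  have hlog : 0 ≤ Real.log s := Real.log_nonneg hs
  calc heightProfile s ≤ 1 * Real.log s :=
        mul_le_mul_of_nonneg_right (Real.smoothTransition.le_one _) hlog
    _ = Real.log s := one_mul _

/-- `g` is `C^∞` on `ℝ`: near `s < 1` it vanishes identically, near `s ≥ 1` it is a product of
smooth functions (`log` is smooth off `0`). [folklore] -/
theorem contDiff_heightProfile : ContDiff ℝ ∞ heightProfile := by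
  rw [contDiff_iff_contDiffAt]
  intro s
  rcases lt_or_ge s 1 with hs | hs
  · have h : heightProfile =ᶠ[𝓝 s] fun _ ↦ 0 := by
      filter_upwards [Iio_mem_nhds hs] with u hu
      exact heightProfile_of_le_one (le_of_lt hu)
    exact (contDiffAt_const (c := (0 : ℝ))).congr_of_eventuallyEq h
  · have hs0 : s ≠ 0 := by positivity
    exact ((Real.smoothTransition.contDiff.comp (contDiff_id.sub contDiff_const)).contDiffAt).mul
      (Real.contDiffAt_log.mpr hs0)

/-- `g'(s) = 1/s` for `s > 2` (there `g = log` locally). [folklore] -/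
theorem deriv_heightProfile_of_two_lt {s : ℝ} (hs : 2 < s) : deriv heightProfile s = s⁻¹ := by
  have h : heightProfile =ᶠ[𝓝 s] Real.log := by
    filter_upwards [Ioi_mem_nhds hs] with u hu
    exact heightProfile_of_two_le (le_of_lt hu)
  rw [h.deriv_eq, Real.deriv_log]

/-- `|g'| ≤ B` on `[0, 2]` for some `B ≥ 0` (a continuous function on a compact interval).
[folklore] -/
theorem exists_bound_deriv_heightProfile :
    ∃ B : ℝ, 0 ≤ B ∧ ∀ s ∈ Icc (0 : ℝ) 2, |deriv heightProfile s| ≤ B := by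
  obtain ⟨B, hB⟩ := (isCompact_Icc (a := (0 : ℝ)) (b := 2)).exists_bound_of_continuousOn
    ((contDiff_heightProfile.continuous_deriv (by norm_num)).continuousOn)
  refine ⟨max B 0, le_max_right _ _, fun s hs ↦ ?_⟩
  have := hB s hs
  rw [Real.norm_eq_abs] at this
  exact this.trans (le_max_left _ _)

/-- The **interpolating height function** `F_{M,λ}(y) = M · g(‖y‖²/λ²)`: it vanishes on
`{‖y‖ ≤ λ}` (so its graph is the Kerr–Schild leaf there) and equals `2M log ‖y‖ − 2M log λ` for
`‖y‖ ≥ √2 λ` (so its graph is asymptotic to a Dafermos–Rodnianski–Shlapentokh-Rothman slice); cf.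
arXiv:1010.5132, §4.4. [folklore] -/
def heightFn (M l : ℝ) (y : E3) : ℝ := M * heightProfile (‖y‖ ^ 2 / l ^ 2)

/-- `F_{M,λ} = 0` on the ball `{‖y‖ ≤ λ}`. [folklore] -/
theorem heightFn_of_norm_le {M l : ℝ} (hl : 0 < l) {y : E3} (hy : ‖y‖ ≤ l) :
    heightFn M l y = 0 := by
  have h : ‖y‖ ^ 2 / l ^ 2 ≤ 1 := by
    rw [div_le_one (by positivity)]
    exact pow_le_pow_left₀ (norm_nonneg _) hy 2
  rw [heightFn, heightProfile_of_le_one h, mul_zero]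

/-- `F_{M,λ} ≥ 0` for `M ≥ 0`. [folklore] -/
theorem heightFn_nonneg {M : ℝ} (hM : 0 ≤ M) (l : ℝ) (y : E3) : 0 ≤ heightFn M l y :=
  mul_nonneg hM (heightProfile_nonneg _)

/-- **Sublinear growth**: `F_{M,λ}(y) ≤ 2M ‖y‖ / λ` (`log x ≤ x − 1`). [folklore] -/
theorem heightFn_le {M l : ℝ} (hM : 0 ≤ M) (hl : 0 < l) (y : E3) :
    heightFn M l y ≤ 2 * M * ‖y‖ / l := by
  rcases le_or_gt ‖y‖ l with hy | hy
  · rw [heightFn_of_norm_le hl hy]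
    positivity
  · have hy0 : 0 < ‖y‖ := hl.trans hy
    have hs : 1 ≤ ‖y‖ ^ 2 / l ^ 2 := by
      rw [le_div_iff₀ (by positivity), one_mul]
      exact pow_le_pow_left₀ hl.le hy.le 2
    have hlog : Real.log (‖y‖ ^ 2 / l ^ 2) ≤ 2 * ‖y‖ / l := by
      have h1 : Real.log (‖y‖ ^ 2 / l ^ 2) = 2 * Real.log (‖y‖ / l) := by
        rw [show ‖y‖ ^ 2 / l ^ 2 = (‖y‖ / l) ^ 2 by ring, Real.log_pow]
        norm_num
      rw [h1]
      have h2 := Real.log_le_sub_one_of_pos (show 0 < ‖y‖ / l by positivity)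
      have h3 : 2 * Real.log (‖y‖ / l) ≤ 2 * (‖y‖ / l) := by linarith
      calc 2 * Real.log (‖y‖ / l) ≤ 2 * (‖y‖ / l) := h3
        _ = 2 * ‖y‖ / l := by ring
    calc heightFn M l y ≤ M * Real.log (‖y‖ ^ 2 / l ^ 2) :=
          mul_le_mul_of_nonneg_left (heightProfile_le_log hs) hM
      _ ≤ M * (2 * ‖y‖ / l) := mul_le_mul_of_nonneg_left hlog hM
      _ = 2 * M * ‖y‖ / l := by ring

/-- **Asymptotics**: for `‖y‖² ≥ 2λ²`, `F_{M,λ}(y) − 2M log ‖y‖ = −2M log λ`. [folklore] -/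
theorem heightFn_eq_of_le_norm_sq {M l : ℝ} (hl : 0 < l) {y : E3} (hy : 2 * l ^ 2 ≤ ‖y‖ ^ 2) :
    heightFn M l y - 2 * M * Real.log ‖y‖ = -(2 * M * Real.log l) := by
  have hs : 2 ≤ ‖y‖ ^ 2 / l ^ 2 := by rwa [le_div_iff₀ (by positivity)]
  have hy0 : ‖y‖ ≠ 0 := by
    intro h; rw [h] at hy; nlinarith
  rw [heightFn, heightProfile_of_two_le hs, Real.log_div (pow_ne_zero 2 hy0) (pow_ne_zero 2 hl.ne'),
    Real.log_pow, Real.log_pow]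
  push_cast
  ring

/-- `F_{M,λ}(y) − 2M log ‖y‖ → −2M log λ` as `‖y‖ → ∞` (it is eventually constant): condition
(iii') of `Kerr.IsAdmissibleHeight`. [folklore] -/
theorem tendsto_heightFn_sub_log {M l : ℝ} (hl : 0 < l) :
    Tendsto (fun y : E3 ↦ heightFn M l y - 2 * M * Real.log ‖y‖) (cocompact E3)
      (𝓝 (-(2 * M * Real.log l))) := by
  refine (tendsto_const_nhds (x := -(2 * M * Real.log l))).congr' ?_
  have hmem : (Metric.closedBall (0 : E3) (2 * l))ᶜ ∈ cocompact E3 :=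
    (isCompact_closedBall (0 : E3) (2 * l)).compl_mem_cocompact
  filter_upwards [hmem] with y hy
  rw [Set.mem_compl_iff, Metric.mem_closedBall, dist_zero_right, not_le] at hy
  refine (heightFn_eq_of_le_norm_sq hl ?_).symm
  nlinarith [norm_nonneg y]

/-- `F_{M,λ}` is `C^∞` (composite of `g` with the smooth map `y ↦ ‖y‖²/λ²`). [folklore] -/
theorem contDiff_heightFn (M l : ℝ) : ContDiff ℝ ∞ (heightFn M l) :=
  contDiff_const.mul (contDiff_heightProfile.comp ((contDiff_norm_sq ℝ).div_const _))

/-- **Chain rule bound**: `‖dF_{M,λ}(y)‖ ≤ |M| · |g'(‖y‖²/λ²)| · (2‖y‖/λ²)` (the differential of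
`‖y‖²` is `2⟨y, ·⟩`, of norm `2‖y‖`). [folklore] -/
theorem norm_fderiv_heightFn_le (M l : ℝ) (y : E3) :
    ‖fderiv ℝ (heightFn M l) y‖ ≤
      |M| * |deriv heightProfile (‖y‖ ^ 2 / l ^ 2)| * ((l ^ 2)⁻¹ * 2 * ‖y‖) := by
  have h1 : HasFDerivAt (fun y : E3 ↦ ‖y‖ ^ 2 / l ^ 2) ((l ^ 2)⁻¹ • (2 • innerSL ℝ y)) y := by
    have := (hasStrictFDerivAt_norm_sq y).hasFDerivAt.mul_const ((l ^ 2)⁻¹)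
    simp only [div_eq_mul_inv]
    convert this using 1
  have h2 : HasDerivAt heightProfile (deriv heightProfile (‖y‖ ^ 2 / l ^ 2)) (‖y‖ ^ 2 / l ^ 2) :=
    ((contDiff_heightProfile.differentiable (by norm_num)).differentiableAt).hasDerivAt
  have h3 : HasFDerivAt (fun y : E3 ↦ M * heightProfile (‖y‖ ^ 2 / l ^ 2))
      (M • (deriv heightProfile (‖y‖ ^ 2 / l ^ 2) • ((l ^ 2)⁻¹ • (2 • innerSL ℝ y)))) y :=
    (h2.comp_hasFDerivAt y h1 :).const_mul M
  have hF : heightFn M l = fun y : E3 ↦ M * heightProfile (‖y‖ ^ 2 / l ^ 2) := rfl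
  rw [hF, h3.fderiv, norm_smul, norm_smul, norm_smul, Real.norm_eq_abs, Real.norm_eq_abs,
    Real.norm_eq_abs, abs_of_nonneg (by positivity : (0 : ℝ) ≤ (l ^ 2)⁻¹)]
  have h4 : ‖(2 • innerSL ℝ y : E3 →L[ℝ] ℝ)‖ ≤ 2 * ‖y‖ := by
    calc ‖(2 • innerSL ℝ y : E3 →L[ℝ] ℝ)‖ ≤ 2 * ‖(innerSL ℝ y : E3 →L[ℝ] ℝ)‖ := norm_nsmul_le
      _ = 2 * ‖y‖ := by rw [innerSL_apply_norm]
  have h5 : 0 ≤ |M| * |deriv heightProfile (‖y‖ ^ 2 / l ^ 2)| * (l ^ 2)⁻¹ := by positivity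
  calc |M| * (|deriv heightProfile (‖y‖ ^ 2 / l ^ 2)| * ((l ^ 2)⁻¹ * ‖(2 • innerSL ℝ y : E3 →L[ℝ] ℝ)‖))
      = (|M| * |deriv heightProfile (‖y‖ ^ 2 / l ^ 2)| * (l ^ 2)⁻¹) *
          ‖(2 • innerSL ℝ y : E3 →L[ℝ] ℝ)‖ := by ring
    _ ≤ (|M| * |deriv heightProfile (‖y‖ ^ 2 / l ^ 2)| * (l ^ 2)⁻¹) * (2 * ‖y‖) :=
      mul_le_mul_of_nonneg_left h4 h5
    _ = _ := by ring

/-- **Uniform slope bound**: `‖dF_{M,λ}(y)‖ ≤ (4MB + 2M)/λ` for `M ≥ 0`, `λ > 0`, where `B` bounds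
`|g'|` on `[0, 2]` (on `‖y‖² ≤ 2λ²` use `|g'| ≤ B`, `‖y‖ ≤ 2λ`; beyond, `g' = 1/s` gives
`2M/‖y‖ ≤ 2M/λ`). Hence the slope is `≤ 1/2` once `λ ≥ 8MB + 4M`. [folklore] -/
theorem norm_fderiv_heightFn_le_div {M l B : ℝ} (hM : 0 ≤ M) (hl : 0 < l) (hB0 : 0 ≤ B)
    (hB : ∀ s ∈ Icc (0 : ℝ) 2, |deriv heightProfile s| ≤ B) (y : E3) :
    ‖fderiv ℝ (heightFn M l) y‖ ≤ (4 * M * B + 2 * M) / l := by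
  have h0 := norm_fderiv_heightFn_le M l y
  rw [abs_of_nonneg hM] at h0
  have hl2 : 0 < l ^ 2 := by positivity
  rcases le_or_gt (‖y‖ ^ 2) (2 * l ^ 2) with hy | hy
  · have hs : ‖y‖ ^ 2 / l ^ 2 ∈ Icc (0 : ℝ) 2 :=
      ⟨by positivity, by rwa [div_le_iff₀ hl2]⟩
    have hgB := hB _ hs
    have hy2 : ‖y‖ ≤ 2 * l := by nlinarith [norm_nonneg y]
    calc ‖fderiv ℝ (heightFn M l) y‖
        ≤ M * |deriv heightProfile (‖y‖ ^ 2 / l ^ 2)| * ((l ^ 2)⁻¹ * 2 * ‖y‖) := h0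
      _ ≤ M * B * ((l ^ 2)⁻¹ * 2 * (2 * l)) := by gcongr
      _ = (4 * M * B) / l := by field_simp; ring
      _ ≤ (4 * M * B + 2 * M) / l := by gcongr; linarith
  · have hs : 2 < ‖y‖ ^ 2 / l ^ 2 := by rwa [lt_div_iff₀ hl2]
    have hyl : l ≤ ‖y‖ := by nlinarith [norm_nonneg y]
    have hy0 : 0 < ‖y‖ := hl.trans_le hyl
    rw [deriv_heightProfile_of_two_lt hs] at h0
    calc ‖fderiv ℝ (heightFn M l) y‖
        ≤ M * |(‖y‖ ^ 2 / l ^ 2)⁻¹| * ((l ^ 2)⁻¹ * 2 * ‖y‖) := h0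
      _ = 2 * M / ‖y‖ := by
          rw [abs_of_nonneg (by positivity)]
          field_simp
      _ ≤ 2 * M / l := by gcongr
      _ ≤ (4 * M * B + 2 * M) / l := by gcongr; nlinarith

/-- **The interpolating height function is admissible** for `M ≥ 0` once the scale is large,
`λ ≥ 8MB + 4M` (`B` a bound for `|g'|` on `[0, 2]`): it is smooth, has slope `≤ 1/2`, and
`F_{M,λ} − 2M log ‖y‖ → −2M log λ`. In particular `Kerr.IsAdmissibleHeight M` is inhabited.
[folklore] -/
theorem isAdmissibleHeight_heightFn {M l B : ℝ} (hM : 0 ≤ M) (hl : 0 < l) (hB0 : 0 ≤ B)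
    (hB : ∀ s ∈ Icc (0 : ℝ) 2, |deriv heightProfile s| ≤ B) (hlB : 8 * M * B + 4 * M ≤ l) :
    Kerr.IsAdmissibleHeight M (heightFn M l) := by
  refine ⟨contDiff_heightFn M l, ⟨1 / 2, by norm_num, fun y ↦ ?_⟩, _, tendsto_heightFn_sub_log hl⟩
  have h := norm_fderiv_heightFn_le_div hM hl hB0 hB y
  have h2 : (4 * M * B + 2 * M) / l ≤ 1 / 2 := by
    rw [div_le_iff₀ hl]; linarith
  linarith

/-! ### The reduction of `drsr_wave_boundedness_kerr` to the three facts -/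

/-- Points of a compact subset of the exterior have bounded spatial radius (the spatial radius is
continuous). [folklore] -/
theorem exists_spatialNorm_le_of_isCompact {M a : ℝ} {K : Set (Kerr.exterior M a)}
    (hK : IsCompact K) : ∃ ρ : ℝ, 0 ≤ ρ ∧ ∀ x ∈ K, E4.spatialNorm (x : E4) ≤ ρ := by
  have hcont : Continuous fun x : Kerr.exterior M a ↦ E4.spatialNorm (x : E4) :=
    continuous_norm.comp (E4.spatial.continuous.comp continuous_subtype_val)
  obtain ⟨C, hC⟩ := hK.exists_bound_of_continuousOn hcont.continuousOn
  refine ⟨max C 0, le_max_right _ _, fun x hx ↦ ?_⟩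
  have := hC x hx
  rw [Real.norm_eq_abs, abs_of_nonneg (E4.spatialNorm_nonneg _)] at this
  exact this.trans (le_max_left _ _)

/-- A point of `E4` is `(x⁰, x⃗)` (`E4.ofTimeSpace_time_spatial` with `E4.time x = x 0`).
[folklore] -/
theorem eq_ofTimeSpace (x : E4) : x = E4.ofTimeSpace (x 0) (E4.spatial x) :=
  (E4.ofTimeSpace_time_spatial x).symm

/-- **Reduction of gr.S24 boundedness to the printed theorem.** The named fact
`drsr_wave_boundedness_kerr` of `BlackHoles.lean` (uniform boundedness of the coordinate energy
through the Kerr–Schild leaves `{t* = τ} ∩ {r > r₊}`) follows from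
Dafermos–Rodnianski–Shlapentokh-Rothman's Theorem 3.1 (23) for admissible hypersurfaces
(`DafermosRodnianskiShlapentokhRothman2016_energyBoundedness`), the far-region `J^T` comparison
(`kerr_far_TEnergy_comparison`) and finite speed of propagation
(`kerr_finite_speed_of_propagation`). Proof: with `B` a bound for `|g'|` on `[0, 2]` put
`λ = max (2(4MB + 2M), 8M, R_af + 1)` (`R_af = Kerr.afRadius a r₊`) and `F = heightFn M λ`; then
`F` is admissible with slope `≤ 1/2`, vanishes on `{‖y‖ ≤ λ}`, and `0 ≤ F ≤ ‖y‖/2`; `T` is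
timelike with `2H ≤ 1/2` on `{‖x⃗‖ ≥ λ}` (`Kerr.two_mul_scalarH_le_half`) and `{‖y‖ > λ}` lies in
the exterior slice (`Kerr.mem_slice_of_lt_norm`). For an admissible wave `ψ` with data supported
in a compact `K ⊆ {‖x⃗‖ ≤ ρ}`, finite speed of propagation makes `ψ, dψ` vanish on
`{x⁰ ≥ 0, ‖x⃗‖ > ρ + x⁰}`; hence the data of `ψ` on the graph of `F` are supported in the compact
`K ∪ {(F(y), y) : λ ≤ ‖y‖ ≤ 2ρ}`, and `ψ` vanishes on the wedges `{τ ≤ x⁰ ≤ τ + F}` beyond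
`‖x⃗‖ = 2(ρ + τ) + 1`. Splitting each energy into the parts over `{‖y‖ ≤ λ}` (where the graphs of
`0` and `F` coincide) and `{‖y‖ > λ}` (compared by the `J^T` identity with constant `C_B`) gives,
with `D = max 1 C_B`, `E_KS(τ) ≤ D E_F(τ) ≤ D C_A E_F(0) ≤ D C_A D E_KS(0)`; the constant
`D C_A D < ∞` depends only on `(M, a)`. This is the argument of Dafermos–Rodnianski for
Prop. 4.6.1 of arXiv:1010.5132, §4.6. [cite: DafermosRodnianski2010KerrSmallA, §4.6 Prop. 4.6.1] -/
theorem drsr_wave_boundedness_kerr_of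
    (hA : DafermosRodnianskiShlapentokhRothman2016_energyBoundedness)
    (hB : kerr_far_TEnergy_comparison) (hC : kerr_finite_speed_of_propagation) :
    drsr_wave_boundedness_kerr := by
  intro instF instS M a hMa
  have hM : 0 < M := hMa.pos
  -- the height function and its scale
  obtain ⟨B, hB0, hBd⟩ := exists_bound_deriv_heightProfile
  set A : ℝ := 4 * M * B + 2 * M with hA_def
  have hA0 : 0 ≤ A := by positivity
  set l : ℝ := max (max (2 * A) (8 * M)) (Kerr.afRadius a (Kerr.rPlus M a) + 1) with hl_def
  have hl_A : 2 * A ≤ l := (le_max_left _ _).trans (le_max_left _ _)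
  have hl_8M : 8 * M ≤ l := (le_max_right _ _).trans (le_max_left _ _)
  have hl_af : Kerr.afRadius a (Kerr.rPlus M a) < l :=
    (lt_add_one _).trans_le (le_max_right _ _)
  have hl : 0 < l := by linarith
  have hl_4M : 4 * M ≤ l := by linarith
  set F : E3 → ℝ := heightFn M l with hF_def
  have hF_smooth : ContDiff ℝ ∞ F := contDiff_heightFn M l
  have hF_slope : ∀ y : E3, ‖fderiv ℝ F y‖ ≤ 1 - 1 / 2 := by
    intro y
    have h := norm_fderiv_heightFn_le_div hM.le hl hB0 hBd y
    have h2 : A / l ≤ 1 / 2 := by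
      rw [div_le_iff₀ hl]; linarith
    rw [← hA_def] at h
    linarith
  have hF_zero : ∀ y : E3, ‖y‖ ≤ l → F y = 0 := fun y hy ↦ heightFn_of_norm_le hl hy
  have hF_nonneg : ∀ y : E3, 0 ≤ F y := heightFn_nonneg hM.le l
  have hF_half : ∀ y : E3, F y ≤ ‖y‖ / 2 := by
    intro y
    have h := heightFn_le hM.le hl y
    have : 2 * M * ‖y‖ / l ≤ ‖y‖ / 2 := by
      rw [div_le_div_iff₀ hl (by norm_num : (0:ℝ) < 2)]
      nlinarith [norm_nonneg y]
    exact h.trans this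
  have hF_adm : Kerr.IsAdmissibleHeight M F :=
    ⟨hF_smooth, ⟨1 / 2, by norm_num, hF_slope⟩, _, tendsto_heightFn_sub_log hl⟩
  -- slice membership and timelikeness of `T` far out
  have hslice : ∀ y : E3, l < ‖y‖ → y ∈ Kerr.slice a (Kerr.rPlus M a) :=
    fun y hy ↦ Kerr.mem_slice_of_lt_norm (hl_af.trans hy)
  have hT : ∀ x : E4, x ∈ Kerr.exterior M a → l ≤ E4.spatialNorm x →
      2 * Kerr.scalarH M a x ≤ 1 - 1 / 2 := by
    intro x hx hfar
    have := Kerr.two_mul_scalarH_le_half hMa hx (hl_8M.trans hfar)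
    linarith
  -- the two facts with constants
  obtain ⟨CA, hCA, hAψ⟩ := hA M a hMa F hF_adm
  have hzero_smooth : ContDiff ℝ ∞ (0 : E3 → ℝ) := contDiff_const
  have hzero_slope : ∀ y : E3, ‖fderiv ℝ (0 : E3 → ℝ) y‖ ≤ 1 - 1 / 2 := by
    intro y; simp; norm_num
  obtain ⟨CB, hCB, hBψ⟩ := hB M a hMa 0 F l (1 / 2) (by norm_num) hzero_smooth hF_smooth
    hzero_slope hF_slope (fun y hy ↦ by simp [hF_zero y hy]) (fun y ↦ by simpa using hF_nonneg y)
    hslice hT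
  -- the constant
  set D : ℝ≥0∞ := max 1 CB with hD_def
  have hD : D < ⊤ := max_lt ENNReal.one_lt_top hCB
  refine ⟨D * CA * D, ENNReal.mul_lt_top (ENNReal.mul_lt_top hD hCA) hD, fun ψ hψ τ hτ ↦ ?_⟩
  obtain ⟨hsmooth, hsol, K, hK, hdata⟩ := hψ
  obtain ⟨ρ, hρ0, hρ⟩ := exists_spatialNorm_le_of_isCompact hK
  -- finite speed of propagation
  have hvan : ∀ x : Kerr.exterior M a, 0 ≤ (x : E4) 0 → ρ + (x : E4) 0 < E4.spatialNorm (x : E4) →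
      ψ x = 0 ∧ mfderiv 𝓘(ℝ, E4) 𝓘(ℝ, ℝ) ψ x = 0 := by
    refine hC M a hMa ψ hsmooth hsol ρ fun x hx0 hxρ ↦ hdata x hx0 fun hxK ↦ ?_
    exact absurd (hρ x hxK) (not_le.mpr hxρ)
  -- `ψ` has compactly supported data on the graph of `F`
  have hψF : IsAdmissibleKerrWaveOn M a F ψ := by
    refine ⟨hsmooth, hsol, ?_⟩
    set B₂ : Set E4 := (fun y : E3 ↦ E4.ofTimeSpace (F y) y) '' {y | l ≤ ‖y‖ ∧ ‖y‖ ≤ 2 * ρ}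
      with hB₂_def
    have hB₂c : IsCompact B₂ := by
      refine IsCompact.image ?_ ?_
      · have : {y : E3 | l ≤ ‖y‖ ∧ ‖y‖ ≤ 2 * ρ} =
            {y | l ≤ ‖y‖} ∩ Metric.closedBall 0 (2 * ρ) := by
          ext y; simp [Metric.mem_closedBall, dist_zero_right]
        rw [this]
        exact (isCompact_closedBall _ _).inter_left (isClosed_le continuous_const continuous_norm)
      · exact E4.continuous_ofTimeSpace' hF_smooth.continuous continuous_id
    have hB₂sub : B₂ ⊆ (Kerr.exterior M a : Set E4) := by
      rintro _ ⟨y, ⟨hy1, _⟩, rfl⟩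
      exact Kerr.ofTimeSpace_mem_exterior_iff.mpr (Kerr.mem_slice_of_lt_norm (hl_af.trans_le hy1))
    set K' : Set (Kerr.exterior M a) := K ∪ Subtype.val ⁻¹' B₂ with hK'_def
    have hK'c : IsCompact K' := by
      refine hK.union ?_
      have hrange : B₂ ⊆ Set.range (Subtype.val : Kerr.exterior M a → E4) :=
        fun x hx ↦ ⟨⟨x, hB₂sub hx⟩, rfl⟩
      rw [Topology.IsEmbedding.subtypeVal.isCompact_iff, Set.image_preimage_eq_of_subset hrange]
      exact hB₂c
    refine ⟨K', hK'c, fun x hx0 hxK' ↦ ?_⟩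
    set y : E3 := E4.spatial (x : E4) with hy_def
    have hxy : (x : E4) = E4.ofTimeSpace (F y) y := by rw [← hx0]; exact eq_ofTimeSpace _
    have hsn : E4.spatialNorm (x : E4) = ‖y‖ := rfl
    by_cases hfar : 2 * ρ < ‖y‖
    · refine hvan x (hx0 ▸ hF_nonneg y) ?_
      rw [hsn, hx0]
      linarith [hF_half y]
    · push Not at hfar
      by_cases hnear : l ≤ ‖y‖
      · exact absurd (Or.inr ⟨y, ⟨hnear, hfar⟩, hxy.symm⟩ : x ∈ K') hxK'
      · push Not at hnear
        have h0 : (x : E4) 0 = 0 := by rw [hx0, hF_zero y hnear.le]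
        exact hdata x h0 fun hxK ↦ hxK' (Or.inl hxK)
  -- the far comparison at times `t ≥ 0`
  have hBt : ∀ t : ℝ, 0 ≤ t →
      graphSliceEnergyOn (Kerr.exterior M a) ψ F t {y | l < ‖y‖} ≤
          CB * graphSliceEnergyOn (Kerr.exterior M a) ψ 0 t {y | l < ‖y‖} ∧
        graphSliceEnergyOn (Kerr.exterior M a) ψ 0 t {y | l < ‖y‖} ≤
          CB * graphSliceEnergyOn (Kerr.exterior M a) ψ F t {y | l < ‖y‖} := by
    intro t ht
    refine hBψ ψ t hsmooth hsol ⟨2 * (ρ + t) + 1, fun x hx1 hx2 hx3 ↦ ?_⟩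
    simp only [Pi.zero_apply, add_zero] at hx1
    refine hvan x (ht.trans hx1) ?_
    have hsn : E4.spatialNorm (x : E4) = ‖E4.spatial (x : E4)‖ := rfl
    have hh := hF_half (E4.spatial (x : E4))
    rw [hsn] at hx3 ⊢
    linarith
  -- measurability of the far region; the graphs of `0` and `F` agree over the near region
  have hS : MeasurableSet {y : E3 | l < ‖y‖} :=
    (isOpen_lt continuous_const continuous_norm).measurableSet
  have hagree : ∀ t : ℝ, graphSliceEnergyOn (Kerr.exterior M a) ψ 0 t {y : E3 | l < ‖y‖}ᶜ =
      graphSliceEnergyOn (Kerr.exterior M a) ψ F t {y : E3 | l < ‖y‖}ᶜ := by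
    intro t
    refine graphSliceEnergyOn_congr_height _ ψ t hS.compl fun y hy ↦ ?_
    simp only [Set.mem_compl_iff, Set.mem_setOf_eq, not_lt] at hy
    simp only [Pi.zero_apply]
    exact (hF_zero y hy).symm
  have hD1 : 1 ≤ D := le_max_left _ _
  have hDB : CB ≤ D := le_max_right _ _
  -- near/far decomposition at times `t ≥ 0`, in both directions
  have hcmp1 : ∀ t : ℝ, 0 ≤ t →
      sliceEnergy (Kerr.exterior M a) ψ t ≤ D * graphSliceEnergy (Kerr.exterior M a) ψ F t := by
    intro t ht
    rw [← graphSliceEnergy_zero_height, ← graphSliceEnergyOn_add_compl _ ψ 0 t hS,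
      ← graphSliceEnergyOn_add_compl _ ψ F t hS, hagree t, mul_add]
    gcongr ?_ + ?_
    · exact (hBt t ht).2.trans (by gcongr)
    · exact le_mul_of_one_le_left' hD1
  have hcmp2 : ∀ t : ℝ, 0 ≤ t →
      graphSliceEnergy (Kerr.exterior M a) ψ F t ≤ D * sliceEnergy (Kerr.exterior M a) ψ t := by
    intro t ht
    rw [← graphSliceEnergy_zero_height, ← graphSliceEnergyOn_add_compl _ ψ 0 t hS,
      ← graphSliceEnergyOn_add_compl _ ψ F t hS, hagree t, mul_add]
    gcongr ?_ + ?_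
    · exact (hBt t ht).1.trans (by gcongr)
    · exact le_mul_of_one_le_left' hD1
  calc sliceEnergy (Kerr.exterior M a) ψ τ
      ≤ D * graphSliceEnergy (Kerr.exterior M a) ψ F τ := hcmp1 τ hτ
    _ ≤ D * (CA * graphSliceEnergy (Kerr.exterior M a) ψ F 0) := by
        gcongr; exact hAψ ψ hψF τ hτ
    _ ≤ D * (CA * (D * sliceEnergy (Kerr.exterior M a) ψ 0)) := by
        gcongr; exact hcmp2 0 le_rfl
    _ = D * CA * D * sliceEnergy (Kerr.exterior M a) ψ 0 := by ring

end Literature.Geometry.Lorentzian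

end
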